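import Summits.ResolutionOfSingularities.ResolutionOfSingularities.Theses.Valuative
import Literature.AlgebraicGeometry.Resolution.ResolutionOfSingularities
import Literature.AlgebraicGeometry.Resolution.ResolutionOfComponents
import Literature.AlgebraicGeometry.Resolution.Principalization
import Literature.AlgebraicGeometry.Resolution.EmbeddedResolutionExcellentSurfaces
import Literature.AlgebraicGeometry.Resolution.QuasiExcellentSchemes
import Mathlib

/-!
# Crux `PatchingRel` (stmt-ResolutionOfSingularities-0642) — crux-strategist sketch:
# the dimension-4 atom `FibreConfinedPrinc p 4` (FCP₄) and the dimension-4 engine signature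

See `Cruxes/PatchingRel/STRATEGY-CENSUS.md` §Transfer T3 and idea card
`Ideas/fibre-confined-principalization.md`.
-/

set_option linter.dupNamespace false
set_option linter.unusedVariables false

noncomputable section

namespace Summit.ResolutionOfSingularities.ResolutionOfSingularities.Cruxes.PatchingRel.Strategist

open CategoryTheory AlgebraicGeometry
open Literature.AlgebraicGeometry.Resolution
open Summit.ResolutionOfSingularities.ResolutionOfSingularities

/-- The antecedent of the crux (verbatim body of `Theses.Valuative.PatchingRel`). -/
def LUrelP (p : ℕ) : Prop :=
  ∀ (k K : Type) [Field k] [CharP k p] [Field K] [Algebra k K], (⊤ : IntermediateField k K).FG →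
    ∀ O : ValuationSubring K, (∀ c : k, algebraMap k K c ∈ O) → ∀ R : Subalgebra k K, R.FG →
    R.toSubring ≤ O.toSubring → ∃ (A : Subalgebra k K) (h : A.toSubring ≤ O.toSubring),
      R ≤ A ∧ A.FG ∧ IsFractionRing A K ∧
      IsRegularLocalRing (Localization.AtPrime (Ideal.comap (Subring.inclusion h)
        (IsLocalRing.maximalIdeal O)))

theorem patchingRel_iff_lurelP :
    Theses.Valuative.PatchingRel ↔ ∀ p : ℕ, p.Prime → LUrelP p → ResolutionInChar.{0} p :=
  Iff.rfl

/-- THE ATOM — **fibre-confined principalization over a regular local base of dimension `≤ n`**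
(`FCP_n`): `S` regular local, essentially of finite type over a field of characteristic `p`,
`dim S ≤ n`; `T` integral REGULAR, proper birational over `Spec S`; `J ≠ 0` an ideal sheaf on `T`
which is locally principal at every point off the closed fibre. CLAIM: `J` is principalized by a
finite sequence of blow-ups at integral regular centres lying in the non-locally-principal locus
(`IsRegularCentreBlowupSeq`, the conclusion shape of `CossartPiltant2019Principalization`).
For `n ≤ 3` it is Cossart–Piltant 2019 Prop. 4.4 (+ Zariski in dim 2); the open content is `n = 4`.
It contains embedded resolution of surfaces/curves in regular fourfolds (`T = Bl_pt`, `J = I_W·𝒪_T`,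
`W ⊂ E ≅ 𝐏³`: KNOWN, CJS 2020) and principalization of `𝔪`-primary ideals of 4-dimensional
regular local rings (`T = Spec S`); it does NOT contain resolution of threefolds or fourfolds (the
confinement divisor has dimension 3), so in the dimension-4 slice LU₄ stays load-bearing. Quantified
over ALL `n` it would be ≥ the summit (census §3 (iv)) — which is why it is an atom of the
dimension-4 slice only. -/
def FibreConfinedPrinc (p n : ℕ) : Prop :=
  ∀ (k : Type) [Field k] [CharP k p] (S : Type) [CommRing S] [IsRegularLocalRing S] [Algebra k S]
    [Algebra.EssFiniteType k S], ringKrullDim S ≤ n →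
    ∀ (T : Scheme.{0}) (f : T ⟶ Spec (.of S)), IsIntegral T → IsProper f → IsBirational f →
    Scheme.IsRegular T →
    ∀ J : T.IdealSheafData, J ≠ ⊥ →
    (∀ t : T, f.base t ≠ IsLocalRing.closedPoint S → IsLocallyPrincipalAt J t) →
    ∃ (T' : Scheme.{0}) (σ : T' ⟶ T), IsRegularCentreBlowupSeq σ J ∧ IsLocallyPrincipal (J.comap σ)

/-- The `𝔪`-primary special case (`T = Spec S`): principalization of ideals of a regular local
ring of dimension `≤ n`, essentially of finite type over a field of characteristic `p`, that are
locally principal on the punctured spectrum. The first computations of the line live here. -/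
def PuncturedPrinc (p n : ℕ) : Prop :=
  ∀ (k : Type) [Field k] [CharP k p] (S : Type) [CommRing S] [IsRegularLocalRing S] [Algebra k S]
    [Algebra.EssFiniteType k S], ringKrullDim S ≤ n →
    ∀ J : (Spec (.of S)).IdealSheafData, J ≠ ⊥ →
    (∀ t : Spec (.of S), t ≠ IsLocalRing.closedPoint S → IsLocallyPrincipalAt J t) →
    ∃ (T' : Scheme.{0}) (σ : T' ⟶ Spec (.of S)),
      IsRegularCentreBlowupSeq σ J ∧ IsLocallyPrincipal (J.comap σ)

-- `FCP_n` contains its punctured (`𝔪`-primary) case by `T = Spec S`, `f = 𝟙` (needs only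
-- `IsIntegral (Spec S)`, `IsBirational (𝟙 _)`, `Scheme.IsRegular (Spec S)` from the tree's API;
-- omitted here to keep the sketch sorry-free).

/-- FIRST LEMMA of the line (signature; the dimension-4 ENGINE, census §Transfer T3): modulo the
printed dimension-`≤ 3` theorems (weak resolution `CossartPiltant2019`, principalization on regular
excellent 3-dimensional schemes `CossartPiltant2019Principalization`, CJS embedded resolution of
2-dimensional closed subschemes of regular excellent schemes `CossartJannsenSaito2020Embedded`),
relative LU in characteristic `p` + `FCP₄` give resolution of every integral separated scheme of
finite type of dimension `≤ 4` over every field of characteristic `p` — Piltant 2013 Prop. 5.1 in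
transcendence degree 4 with every use of Axiom 4 localized by noetherian induction on the image of
the non-principal locus (maximal points of `dim 𝒪 = 2, 3` by Zariski / CP2019, closures of centres
of dimension `≤ 2` regularized by CJS, closed points by `FCP₄`), Cor. 5.7 with the tree's
`ZariskiRiemannSpace.compactSpace`, and `resolutionInChar`-style component gluing. -/
def DimFourEngine : Prop :=
  CossartPiltant2019.{0} → CossartPiltant2019Principalization.{0} →
    CossartJannsenSaito2020Embedded.{0} →
    ∀ p : ℕ, p.Prime → LUrelP p → FibreConfinedPrinc p 4 →
      ∀ (k : Type) [Field k] [CharP k p], IntegralResolutionOverUpToDim k 4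

/-- How the engine feeds the crux's dimension-4 slice `PatchingRelDimLeFour` (the child of the
prepared split, census Dc3): literally by application. -/
theorem dimLeFour_of_engine (hE : DimFourEngine) (h₁ : CossartPiltant2019.{0})
    (h₂ : CossartPiltant2019Principalization.{0}) (h₃ : CossartJannsenSaito2020Embedded.{0})
    (hF : ∀ p : ℕ, p.Prime → FibreConfinedPrinc p 4) :
    ∀ p : ℕ, p.Prime → LUrelP p → ∀ (k : Type) [Field k] [CharP k p] (X : Scheme.{0})
      (f : X ⟶ Spec (.of k)), IsSeparated f → LocallyOfFiniteType f → QuasiCompact f →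
      IsIntegral X → topologicalKrullDim X ≤ 4 → Scheme.HasResolution X :=
  fun p hp hLU k _ _ X f hsep hft hqc hint hd => hE h₁ h₂ h₃ p hp hLU (hF p hp) k X f hsep hft hqc hint hd

end Summit.ResolutionOfSingularities.ResolutionOfSingularities.Cruxes.PatchingRel.Strategist
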